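import Summits.AtomisticToContinuum.BoseEinsteinCondensation.Theorems.BECConjugateDominationHardCoreExtensionSmoothedGeneratorFubini
import HarnessLib

/-!
# The Feynman–Kac generator under one free smoothing, for BOUNDED MEASURABLE interactions, III:
# assembly — stub `stub_smoothedGenerator` (S6r-B1) of line `third-law-current-floor` for crux
# `HardCoreExtension` (stmt-AtomisticToContinuum-11786)

For `L > 0`, a measurable pair potential `v` with bounded periodisation `v^per ≤ C` — so that the real
interaction `W = (∑_{i<j} v^per(xᵢ - xⱼ)).toReal` is bounded and measurable but possibly DIScontinuous —
a continuous `Lℤ³`-periodic real `Ψ₀`, `s > 0` and `X`: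

  `P_s[h⁻¹ (P_h Ψ₀ - e^{-hH} Ψ₀)](X) ⟶ P_s(W Ψ₀)(X)`   (`h → 0⁺`),

`P_s = heatOp s` the free heat operator and `e^{-hH} = pfkReal v L h` the periodic Feynman–Kac
functional. Without the outer smoothing the limit `h⁻¹(P_hΨ₀ - e^{-hH}Ψ₀) → WΨ₀` holds only at Lebesgue
points of `W`; under `P_s` the only `W`-dependent limit needed is the continuity at `0` of the smoothed
translate of part II, and everything else is the small-time bookkeeping of part I. This is the analytic
heart of the Duhamel identity (S6r-B2) and hence of the `C¹`-regularity of the Feynman–Kac ground state for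
bounded measurable potentials (S6r). [folklore]
-/

noncomputable section

namespace Summit.AtomisticToContinuum.BoseEinsteinCondensation.Cruxes.HardCoreExtension.ThirdLawCurrentFloor

open MeasureTheory ProbabilityTheory Filter Set Metric
open scoped ENNReal NNReal Topology
open Literature.MathematicalPhysics.QuantumManyBody.BoseGas
open Literature.Probability.Process (brownian runSup runSup_nonneg)
open Summit.AtomisticToContinuum.BoseEinsteinCondensation.Theorems.PositiveMinimiser

namespace SmoothedGenerator

variable {N : ℕ} {v : ℝ → ℝ≥0∞} {L : ℝ} {C : ℝ≥0}

/-! ### Assembly -/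

section Assembly

variable {Ψ₀ : Config N → ℝ} {M : ℝ}

/-- `|e^{-hH}Ψ₀(Y)| ≤ M` for `|Ψ₀| ≤ M` (the weight lies in `[0, 1]`). [folklore] -/
theorem abs_pfkReal_le_bound (hM : ∀ Y, |Ψ₀ Y| ≤ M) (h : ℝ) (Y : Config N) :
    |pfkReal v L h Ψ₀ Y| ≤ M := by
  have hM0 : 0 ≤ M := (abs_nonneg _).trans (hM 0)
  rw [pfkReal, ← Real.norm_eq_abs]
  refine (norm_integral_le_integral_norm _).trans ?_
  refine (integral_mono_of_nonneg (Eventually.of_forall fun _ => norm_nonneg _) (integrable_const M)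
    (Eventually.of_forall fun ω => ?_)).trans (le_of_eq (by simp))
  simp only [norm_mul, Real.norm_eq_abs, abs_of_nonneg ENNReal.toReal_nonneg]
  calc (periodicFKWeight v L h Y ω).toReal * |Ψ₀ (worldLine Y ω h.toNNReal)| ≤ 1 * M :=
        mul_le_mul (toReal_periodicFKWeight_le_one v L h Y ω) (hM _) (abs_nonneg _) zero_le_one
    _ = M := one_mul M

/-- The mean action is measurable in the starting point (Fubini measurability). [folklore] -/
theorem measurable_meanAction (hv : Measurable v) (L h : ℝ) : Measurable ((fun Y : Config N => ∫ ω, (periodicPathAction v L h Y ω).toReal ∂wienerPaths N)) :=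
  ((measurable_periodicPathAction_uncurry hv L h).ennreal_toReal.stronglyMeasurable.integral_prod_right'
    (ν := wienerPaths N)).measurable

/-- `|Ā_h(Y)| ≤ N²Ch` (`h ≥ 0`). [folklore] -/
theorem abs_meanAction_le (hC : ∀ x, periodizedPotential v L x ≤ C) {h : ℝ} (hh : 0 ≤ h) (Y : Config N) :
    |(∫ ω, (periodicPathAction v L h Y ω).toReal ∂wienerPaths N)| ≤ ((N * N : ℕ) : ℝ) * C * h := by
  rw [← Real.norm_eq_abs]
  refine (norm_integral_le_integral_norm _).trans ?_
  refine (integral_mono_of_nonneg (Eventually.of_forall fun _ => norm_nonneg _)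
    (integrable_const (((N * N : ℕ) : ℝ) * C * h)) (Eventually.of_forall fun ω => ?_)).trans (le_of_eq (by simp))
  obtain ⟨h0, h1⟩ := toReal_periodicPathAction_mem hC hh Y ω
  simp only [Real.norm_eq_abs, abs_of_nonneg h0]
  exact h1

/-- The error functional is measurable in the starting point. [folklore] -/
theorem measurable_errPiece (hv : Measurable v) (hcont : Continuous Ψ₀) (hMn : ∀ Y, ‖Ψ₀ Y‖ ≤ M) (h : ℝ) :
    Measurable ((fun Y : Config N => heatOpR h Ψ₀ Y - pfkReal v L h Ψ₀ Y - h * (periodicInteraction v L Y).toReal * Ψ₀ Y)) := by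
  refine (((continuous_heatOp hcont hMn h.toNNReal).measurable).sub
    (measurable_pfkReal hv L h hcont.measurable)).sub ?_
  exact ((measurable_const.mul (measurable_Wr hv L)).mul hcont.measurable)

/-- The third piece is measurable in the starting point. [folklore] -/
theorem measurable_thirdPiece (hv : Measurable v) (hΨm : Measurable Ψ₀) (h : ℝ) :
    Measurable ((fun Y : Config N => ((∫ ω, (periodicPathAction v L h Y ω).toReal ∂wienerPaths N) - h * (periodicInteraction v L Y).toReal) * Ψ₀ Y)) :=
  ((measurable_meanAction hv L h).sub (measurable_const.mul (measurable_Wr hv L))).mul hΨm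

/-- **Algebra of the difference quotient under the smoothing**: for `h ≠ 0`,
`P_s[h⁻¹(P_hΨ₀ − e^{-hH}Ψ₀)](X) − P_s(WΨ₀)(X) = h⁻¹ (P_s(E_h − F₃)(X) + P_s F₃ (X))`. [folklore] -/
theorem heatOp_diffQuot_sub_eq (hv : Measurable v) (hC : ∀ x, periodizedPotential v L x ≤ C)
    (hcont : Continuous Ψ₀) (hM : ∀ Y, |Ψ₀ Y| ≤ M) (s : ℝ≥0) {h : ℝ} (hh : 0 < h) (X : Config N) :
    heatOp s (fun Y => h⁻¹ * (heatOpR h Ψ₀ Y - pfkReal v L h Ψ₀ Y)) X -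
        heatOp s (fun Y => (periodicInteraction v L Y).toReal * Ψ₀ Y) X =
      h⁻¹ * (heatOp s (fun Y => (heatOpR h Ψ₀ Y - pfkReal v L h Ψ₀ Y - h * (periodicInteraction v L Y).toReal * Ψ₀ Y) - (((∫ ω, (periodicPathAction v L h Y ω).toReal ∂wienerPaths N) - h * (periodicInteraction v L Y).toReal) * Ψ₀ Y)) X +
        heatOp s ((fun Y : Config N => ((∫ ω, (periodicPathAction v L h Y ω).toReal ∂wienerPaths N) - h * (periodicInteraction v L Y).toReal) * Ψ₀ Y)) X) := by
  have hM0 : 0 ≤ M := (abs_nonneg _).trans (hM 0)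
  have hMn : ∀ Y, ‖Ψ₀ Y‖ ≤ M := fun Y => by rw [Real.norm_eq_abs]; exact hM Y
  have hmd : Measurable fun ω' : PathSpace N => X + displacement s ω' :=
    measurable_const.add (measurable_displacement s)
  -- integrability of the pieces along `ω' ↦ X + √2 b'_s`
  have iD : Integrable (fun ω' : PathSpace N => heatOpR h Ψ₀ (X + displacement s ω') -
      pfkReal v L h Ψ₀ (X + displacement s ω')) (wienerPaths N) := by
    refine Integrable.of_bound ((((continuous_heatOp hcont hMn h.toNNReal).measurable).sub
      (measurable_pfkReal hv L h hcont.measurable)).comp hmd).aestronglyMeasurable (M + M)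
      (Eventually.of_forall fun ω' => ?_)
    rw [Real.norm_eq_abs]
    refine (abs_sub _ _).trans (add_le_add ?_ (abs_pfkReal_le_bound hM h _))
    have := norm_heatOp_le (E := ℝ) hMn h.toNNReal (X + displacement s ω')
    rwa [Real.norm_eq_abs] at this
  have iW : Integrable (fun ω' : PathSpace N => h * (periodicInteraction v L (X + displacement s ω')).toReal * Ψ₀ (X + displacement s ω'))
      (wienerPaths N) := by
    refine Integrable.of_bound (((measurable_const.mul (measurable_Wr hv L)).mul hcont.measurable).comp
      hmd).aestronglyMeasurable (|h| * (((N * N : ℕ) : ℝ) * C) * M) (Eventually.of_forall fun ω' => ?_)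
    rw [Real.norm_eq_abs, abs_mul, abs_mul]
    exact mul_le_mul (mul_le_mul_of_nonneg_left (abs_Wr_le hC _) (abs_nonneg _)) (hM _) (abs_nonneg _)
      (by positivity)
  have iT : Integrable (fun ω' : PathSpace N => (((∫ ω, (periodicPathAction v L h (X + displacement s ω') ω).toReal ∂wienerPaths N) - h * (periodicInteraction v L (X + displacement s ω')).toReal) * Ψ₀ (X + displacement s ω'))) (wienerPaths N) := by
    refine Integrable.of_bound ((measurable_thirdPiece hv hcont.measurable h).comp hmd).aestronglyMeasurable
      ((((N * N : ℕ) : ℝ) * C * h + |h| * (((N * N : ℕ) : ℝ) * C)) * M) (Eventually.of_forall fun ω' => ?_)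
    rw [Real.norm_eq_abs, abs_mul]
    refine mul_le_mul ((abs_sub _ _).trans (add_le_add (abs_meanAction_le hC hh.le _) ?_)) (hM _)
      (abs_nonneg _) (by positivity)
    rw [abs_mul]
    exact mul_le_mul_of_nonneg_left (abs_Wr_le hC _) (abs_nonneg _)
  have iE : Integrable (fun ω' : PathSpace N => (heatOpR h Ψ₀ (X + displacement s ω') - pfkReal v L h Ψ₀ (X + displacement s ω') - h * (periodicInteraction v L (X + displacement s ω')).toReal * Ψ₀ (X + displacement s ω'))) (wienerPaths N) :=
    (iD.sub iW).congr (Eventually.of_forall fun ω' => by simp only [Pi.sub_apply])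
  -- the algebra
  have e1 : heatOp s (fun Y => h⁻¹ * (heatOpR h Ψ₀ Y - pfkReal v L h Ψ₀ Y)) X =
      h⁻¹ * heatOp s (fun Y => heatOpR h Ψ₀ Y - pfkReal v L h Ψ₀ Y) X := by
    simp only [heatOp]; exact integral_const_mul _ _
  have e2 : heatOp s (fun Y => (periodicInteraction v L Y).toReal * Ψ₀ Y) X =
      h⁻¹ * heatOp s (fun Y => h * (periodicInteraction v L Y).toReal * Ψ₀ Y) X := by
    simp only [heatOp]
    rw [← integral_const_mul]
    refine integral_congr_ae (Eventually.of_forall fun ω' => ?_)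
    simp only
    field_simp
  have e3 : heatOp s (fun Y => heatOpR h Ψ₀ Y - pfkReal v L h Ψ₀ Y) X -
      heatOp s (fun Y => h * (periodicInteraction v L Y).toReal * Ψ₀ Y) X = heatOp s ((fun Y : Config N => heatOpR h Ψ₀ Y - pfkReal v L h Ψ₀ Y - h * (periodicInteraction v L Y).toReal * Ψ₀ Y)) X := by
    simp only [heatOp]
    rw [← integral_sub iD iW]
  have e4 : heatOp s ((fun Y : Config N => heatOpR h Ψ₀ Y - pfkReal v L h Ψ₀ Y - h * (periodicInteraction v L Y).toReal * Ψ₀ Y)) X =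
      heatOp s (fun Y => (heatOpR h Ψ₀ Y - pfkReal v L h Ψ₀ Y - h * (periodicInteraction v L Y).toReal * Ψ₀ Y) - (((∫ ω, (periodicPathAction v L h Y ω).toReal ∂wienerPaths N) - h * (periodicInteraction v L Y).toReal) * Ψ₀ Y)) X + heatOp s ((fun Y : Config N => ((∫ ω, (periodicPathAction v L h Y ω).toReal ∂wienerPaths N) - h * (periodicInteraction v L Y).toReal) * Ψ₀ Y)) X := by
    have iET : Integrable (fun ω' : PathSpace N => (heatOpR h Ψ₀ (X + displacement s ω') - pfkReal v L h Ψ₀ (X + displacement s ω') - h * (periodicInteraction v L (X + displacement s ω')).toReal * Ψ₀ (X + displacement s ω')) -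
        (((∫ ω, (periodicPathAction v L h (X + displacement s ω') ω).toReal ∂wienerPaths N) - h * (periodicInteraction v L (X + displacement s ω')).toReal) * Ψ₀ (X + displacement s ω'))) (wienerPaths N) := iE.sub iT
    simp only [heatOp]
    rw [← integral_add iET iT]
    refine integral_congr_ae (Eventually.of_forall fun ω' => ?_)
    simp only [sub_add_cancel]
  rw [e1, e2, ← mul_sub, e3, e4]

end Assembly

end SmoothedGenerator

open SmoothedGenerator in
/-- **S6r-B1 `stub_smoothedGenerator`** (registered stub of line `third-law-current-floor`, crux
`HardCoreExtension`, stmt-AtomisticToContinuum-11786). For `L > 0`, a measurable pair potential with bounded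
periodisation `v^per ≤ C` (so `W = (∑ v^per).toReal` is bounded measurable, possibly discontinuous), a
continuous `Lℤ³`-periodic real `Ψ₀`, `s > 0` and `X`:
`P_s[h⁻¹(P_hΨ₀ − e^{-hH}Ψ₀)](X) → P_s(WΨ₀)(X)` as `h → 0⁺`. Proof: split the smoothed difference quotient
minus its limit as `h⁻¹(P_s(E_h − F₃) + P_s F₃)`; the first piece is `O(h) + N²C·(η + O(√h)/δ)` uniformly
(`|1 − e^{-a} − a| ≤ a²`, uniform continuity of `Ψ₀`, first moment of the displacement), the second is
`h·(η' + O(√h)/δ')` by Fubini and the continuity at `0` of the smoothed translate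
`U ↦ E[Ψ₀(X + √2b_s) W(X + √2b_s + U)]` (dominated convergence in the Gaussian-kernel form). [folklore] -/
theorem stub_smoothedGenerator :
    ∀ {N : ℕ} (L : ℝ) (v : ℝ → ℝ≥0∞) (C : ℝ≥0), 0 < L → Measurable v →
      (∀ x, periodizedPotential v L x ≤ C) →
      ∀ Ψ₀ : Config N → ℝ, Continuous Ψ₀ →
        (∀ (X : Config N) (i : Fin N) (k : Fin 3),
          Ψ₀ (X + Pi.single i (EuclideanSpace.single k L)) = Ψ₀ X) →
        ∀ s : ℝ≥0, s ≠ 0 → ∀ X : Config N,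
          Tendsto (fun h : ℝ => heatOp s (fun Y => h⁻¹ * (heatOpR h Ψ₀ Y - pfkReal v L h Ψ₀ Y)) X)
            (𝓝[>] 0) (𝓝 (heatOp s (fun Y => (periodicInteraction v L Y).toReal * Ψ₀ Y) X)) := by
  intro N L v C hL hv hC Ψ₀ hcont hper s hs X
  obtain ⟨M, hM0, hM⟩ := exists_bound_of_continuous_periodic hL hcont hper
  set CV : ℝ := ((N * N : ℕ) : ℝ) * C with hCV
  have hCV0 : 0 ≤ CV := by positivity
  set Gb : ℝ := M * CV with hGb
  set c : ℝ := Real.sqrt 2 * ((3 * N : ℕ) * 2) with hc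
  have hc0 : 0 ≤ c := by positivity
  rw [Metric.tendsto_nhdsWithin_nhds]
  intro ε hε
  -- uniform continuity of `Ψ₀` at scale `η`
  have hη : 0 < ε / (4 * (CV + 1)) := by positivity
  obtain ⟨δ, hδ, hUC⟩ := periodic_uniformContinuous hL hcont hper hη
  -- continuity of the smoothed translate at `0` at scale `η' = ε/4`
  obtain ⟨δ', hδ', hmod⟩ := exists_delta_smoothedTranslate hv hC hcont hM hs X (η' := ε / 4) (by positivity)
  -- the `h`-dependent remainder tends to `0`
  set φ : ℝ → ℝ := fun h => M * CV ^ 2 * h + CV * (2 * M / δ * (c * Real.sqrt h.toNNReal)) +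
    2 * Gb / δ' * (c * Real.sqrt h.toNNReal) with hφ
  have hφc : Continuous φ := by
    have h1 : Continuous fun h : ℝ => Real.sqrt h.toNNReal :=
      Real.continuous_sqrt.comp (NNReal.continuous_coe.comp continuous_real_toNNReal)
    simp only [hφ]
    fun_prop
  have hφ0 : φ 0 = 0 := by simp [hφ]
  obtain ⟨h₁, hh₁, hφlt⟩ : ∃ h₁ > 0, ∀ h : ℝ, dist h 0 < h₁ → dist (φ h) (φ 0) < ε / 4 :=
    Metric.continuousAt_iff.1 hφc.continuousAt (ε / 4) (by positivity)
  refine ⟨min h₁ (1 / (CV + 1)), lt_min hh₁ (by positivity), fun h hh hdist => ?_⟩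
  have hh0 : 0 < h := hh
  rw [Real.dist_eq, sub_zero, abs_of_pos hh0] at hdist
  have hh₁' : h < h₁ := hdist.trans_le (min_le_left _ _)
  have hsmall : CV * h ≤ 1 := by
    have h2 : h ≤ 1 / (CV + 1) := (hdist.trans_le (min_le_right _ _)).le
    calc CV * h ≤ (CV + 1) * (1 / (CV + 1)) :=
          mul_le_mul (by linarith) h2 hh0.le (by positivity)
      _ = 1 := by field_simp
  have hφh : φ h < ε / 4 := by
    have := hφlt h (by rwa [Real.dist_eq, sub_zero, abs_of_pos hh0])
    rwa [hφ0, Real.dist_eq, sub_zero, abs_of_nonneg] at this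
    simp only [hφ]; positivity
  -- the two bounds
  have hB12 : ∀ Y, |(heatOpR h Ψ₀ Y - pfkReal v L h Ψ₀ Y - h * (periodicInteraction v L Y).toReal * Ψ₀ Y) - (((∫ ω, (periodicPathAction v L h Y ω).toReal ∂wienerPaths N) - h * (periodicInteraction v L Y).toReal) * Ψ₀ Y)| ≤
      M * (CV * h) ^ 2 + CV * h * (ε / (4 * (CV + 1)) + 2 * M / δ * (c * Real.sqrt h.toNNReal)) := by
    intro Y
    have := abs_errPiece_sub_thirdPiece_le hv hC hcont.measurable hM hη.le hδ hUC hh0.le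
      (by rw [← hCV]; exact hsmall) Y
    simp only [← hCV, hc] at this ⊢
    convert this using 3
    ring
  have hB12' : |heatOp s (fun Y => (heatOpR h Ψ₀ Y - pfkReal v L h Ψ₀ Y - h * (periodicInteraction v L Y).toReal * Ψ₀ Y) - (((∫ ω, (periodicPathAction v L h Y ω).toReal ∂wienerPaths N) - h * (periodicInteraction v L Y).toReal) * Ψ₀ Y)) X| ≤
      M * (CV * h) ^ 2 + CV * h * (ε / (4 * (CV + 1)) + 2 * M / δ * (c * Real.sqrt h.toNNReal)) := by
    have := norm_heatOp_le (E := ℝ) (f := fun Y => (heatOpR h Ψ₀ Y - pfkReal v L h Ψ₀ Y - h * (periodicInteraction v L Y).toReal * Ψ₀ Y) - (((∫ ω, (periodicPathAction v L h Y ω).toReal ∂wienerPaths N) - h * (periodicInteraction v L Y).toReal) * Ψ₀ Y))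
      (fun Y => by rw [Real.norm_eq_abs]; exact hB12 Y) s X
    rwa [Real.norm_eq_abs] at this
  have hB3 : |heatOp s ((fun Y : Config N => ((∫ ω, (periodicPathAction v L h Y ω).toReal ∂wienerPaths N) - h * (periodicInteraction v L Y).toReal) * Ψ₀ Y)) X| ≤ h * (ε / 4 + 2 * Gb / δ' * (c * Real.sqrt h.toNNReal)) := by
    have := abs_heatOp_thirdPiece_le hv hC hcont.measurable hM s hh0.le X (by positivity : (0 : ℝ) ≤ ε / 4)
      hδ' hmod
    simp only [← hCV, ← hGb, hc] at this ⊢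
    convert this using 3
    ring
  -- conclusion
  rw [Real.dist_eq]
  change |heatOp s (fun Y => h⁻¹ * (heatOpR h Ψ₀ Y - pfkReal v L h Ψ₀ Y)) X -
    heatOp s (fun Y => (periodicInteraction v L Y).toReal * Ψ₀ Y) X| < ε
  rw [heatOp_diffQuot_sub_eq hv hC hcont hM s hh0 X, abs_mul, abs_of_pos (inv_pos.2 hh0)]
  have hCVη : CV * (ε / (4 * (CV + 1))) ≤ ε / 4 := by
    rw [mul_div_assoc', div_le_div_iff₀ (by positivity) (by positivity)]
    nlinarith
  calc h⁻¹ * |heatOp s (fun Y => (heatOpR h Ψ₀ Y - pfkReal v L h Ψ₀ Y - h * (periodicInteraction v L Y).toReal * Ψ₀ Y) - (((∫ ω, (periodicPathAction v L h Y ω).toReal ∂wienerPaths N) - h * (periodicInteraction v L Y).toReal) * Ψ₀ Y)) X + heatOp s ((fun Y : Config N => ((∫ ω, (periodicPathAction v L h Y ω).toReal ∂wienerPaths N) - h * (periodicInteraction v L Y).toReal) * Ψ₀ Y)) X|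
      ≤ h⁻¹ * (M * (CV * h) ^ 2 + CV * h * (ε / (4 * (CV + 1)) + 2 * M / δ * (c * Real.sqrt h.toNNReal)) +
          h * (ε / 4 + 2 * Gb / δ' * (c * Real.sqrt h.toNNReal))) :=
        mul_le_mul_of_nonneg_left ((abs_add_le _ _).trans (add_le_add hB12' hB3)) (inv_pos.2 hh0).le
    _ = CV * (ε / (4 * (CV + 1))) + ε / 4 + φ h := by
        simp only [hφ]
        field_simp
        ring
    _ < ε := by linarith

end Summit.AtomisticToContinuum.BoseEinsteinCondensation.Cruxes.HardCoreExtension.ThirdLawCurrentFloor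

end
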